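import Mathlib
import Summits.NavierStokesRegularity.NavierStokesRegularity.Theorems.ThreadingFluxHorizonTowerQuadraticGeneratorChart
import Literature.Algebra.Polynomial.FischerHarmonicNormalForm
import HarnessLib

/-!
# Crux `PoloidalLiouville` (stmt-NavierStokesRegularity-1222), crux idea «horizon-threading-tower» (ns-idea-15):
# NULL-CONE DIVISIBILITY — a homogeneous polynomial that dies on the isotropic chart is a multiple of `ρ` (real AND complex)

Support file (`--supports stmt-NavierStokesRegularity-1222`, helper; cell `ns-wall-extremal`, width hand ns-wall-eng-3 g5; 0 kit), toward
THM H «second cone digit for quadratic generators» (towers whose top pair has `gcd = 2`).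

The harmonic Fischer decomposition `𝒫ᵏ = 𝓗ᵏ ⊕ ρ𝒫ᵏ⁻²` is in the tree over `ℝ`
(`Literature.Algebra.Polynomial.FischerDecomposition.exists_harmonic_add_sum_sq_mul_of_isHomogeneous`).  Here:
* `reP`, `imP` — real and imaginary parts of a complex polynomial, `F = map reP + C I · map imP`, homogeneity is inherited;
* ★ `exists_harmonic_add_normSq_mul_complex` — the decomposition over `ℂ` (componentwise);
* ★ `exists_eq_normSq_mul_of_chartT_eq_zero'` (complex) and `exists_eq_normSq_mul_of_chartT_map_eq_zero'` (real), EVERY degree: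
  `chartT F = 0 ⇒ F = ρ · c` with `c` homogeneous of degree `k − 2` (the harmonic part has zero chart, hence vanishes by the
  injectivity of the chart on solid harmonics, p702364).

HONEST LABEL: polynomial algebra about one crux idea's typed objects; no Prop of the sketch is closed here; `HorizonTowerZonality`
(general towers), `PoloidalLiouville` (1222) OPEN; NS regularity NOT proved.  [folklore]
-/

-- the summit and its single sub-problem share the name (CONVENTIONS §1)
set_option linter.dupNamespace false

noncomputable section

open MvPolynomial Complex

namespace Summit.NavierStokesRegularity.NavierStokesRegularity.Theorems.PoloidalLiouville.HorizonTower.Zonal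

/-! ### Real and imaginary parts of a complex polynomial -/

/-- The real part of a complex polynomial (coefficientwise). -/
def reP (F : MvPolynomial (Fin 3) ℂ) : MvPolynomial (Fin 3) ℝ := ∑ d ∈ F.support, monomial d (F.coeff d).re

/-- The imaginary part of a complex polynomial (coefficientwise). -/
def imP (F : MvPolynomial (Fin 3) ℂ) : MvPolynomial (Fin 3) ℝ := ∑ d ∈ F.support, monomial d (F.coeff d).im

/-- Coefficients of the real part. [folklore] -/
theorem coeff_reP (F : MvPolynomial (Fin 3) ℂ) (d : Fin 3 →₀ ℕ) : (reP F).coeff d = (F.coeff d).re := by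
  classical
  rw [reP, coeff_sum]
  simp only [coeff_monomial]
  rw [Finset.sum_ite_eq']
  by_cases hd : d ∈ F.support
  · rw [if_pos hd]
  · rw [if_neg hd, notMem_support_iff.mp hd, Complex.zero_re]

/-- Coefficients of the imaginary part. [folklore] -/
theorem coeff_imP (F : MvPolynomial (Fin 3) ℂ) (d : Fin 3 →₀ ℕ) : (imP F).coeff d = (F.coeff d).im := by
  classical
  rw [imP, coeff_sum]
  simp only [coeff_monomial]
  rw [Finset.sum_ite_eq']
  by_cases hd : d ∈ F.support
  · rw [if_pos hd]
  · rw [if_neg hd, notMem_support_iff.mp hd, Complex.zero_im]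

/-- `F = re F + i · im F`. [folklore] -/
theorem map_reP_add_map_imP (F : MvPolynomial (Fin 3) ℂ) :
    map (algebraMap ℝ ℂ) (reP F) + C I * map (algebraMap ℝ ℂ) (imP F) = F := by
  ext d
  rw [coeff_add, coeff_C_mul, coeff_map, coeff_map, coeff_reP, coeff_imP, mul_comm]
  exact Complex.re_add_im (F.coeff d)

/-- Homogeneity passes to the real part. [folklore] -/
theorem isHomogeneous_reP {F : MvPolynomial (Fin 3) ℂ} {k : ℕ} (hF : F.IsHomogeneous k) : (reP F).IsHomogeneous k := by
  intro d hd
  rw [coeff_reP] at hd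
  exact hF (fun h => hd (by rw [h, Complex.zero_re]))

/-- Homogeneity passes to the imaginary part. [folklore] -/
theorem isHomogeneous_imP {F : MvPolynomial (Fin 3) ℂ} {k : ℕ} (hF : F.IsHomogeneous k) : (imP F).IsHomogeneous k := by
  intro d hd
  rw [coeff_imP] at hd
  exact hF (fun h => hd (by rw [h, Complex.zero_im]))

/-! ### The harmonic Fischer decomposition, real and complex, in the tree's notation -/

/-- The real decomposition `F = h + ρ·c` (Literature, restated with `lapP` and `normSq`). [cite: AxlerBourdonRamey2001, Prop. 5.5] -/
theorem exists_harmonic_add_normSq_mul_real {F : MvPolynomial (Fin 3) ℝ} {k : ℕ} (hF : F.IsHomogeneous k) :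
    ∃ h c : MvPolynomial (Fin 3) ℝ, h.IsHomogeneous k ∧ lapP h = 0 ∧ c.IsHomogeneous (k - 2) ∧ F = h + normSq * c := by
  obtain ⟨h, c, hh, hΔ, hc, hF'⟩ :=
    Literature.Algebra.Polynomial.FischerDecomposition.exists_harmonic_add_sum_sq_mul_of_isHomogeneous (ι := Fin 3) hF
  refine ⟨h, c, hh, ?_, hc, ?_⟩
  · rw [Fin.sum_univ_three] at hΔ; exact hΔ
  · rw [Fin.sum_univ_three] at hF'; exact hF'

/-- ★ **The complex decomposition `F = h + ρ·c`** (componentwise from the real one). [folklore] -/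
theorem exists_harmonic_add_normSq_mul_complex {F : MvPolynomial (Fin 3) ℂ} {k : ℕ} (hF : F.IsHomogeneous k) :
    ∃ h c : MvPolynomial (Fin 3) ℂ, h.IsHomogeneous k ∧ lapP h = 0 ∧ c.IsHomogeneous (k - 2) ∧ F = h + normSq * c := by
  obtain ⟨h₁, c₁, hh₁, hΔ₁, hc₁, hF₁⟩ := exists_harmonic_add_normSq_mul_real (isHomogeneous_reP hF)
  obtain ⟨h₂, c₂, hh₂, hΔ₂, hc₂, hF₂⟩ := exists_harmonic_add_normSq_mul_real (isHomogeneous_imP hF)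
  refine ⟨map (algebraMap ℝ ℂ) h₁ + C I * map (algebraMap ℝ ℂ) h₂, map (algebraMap ℝ ℂ) c₁ + C I * map (algebraMap ℝ ℂ) c₂,
    (hh₁.map _).add ((hh₂.map _).C_mul _), ?_, (hc₁.map _).add ((hc₂.map _).C_mul _), ?_⟩
  · rw [lapP_add, ← map_lapP, hΔ₁, map_zero, zero_add, lapP_C_mul, ← map_lapP, hΔ₂, map_zero, mul_zero]
  · rw [← map_reP_add_map_imP F, hF₁, hF₂, map_add, map_add, map_mul, map_mul]
    have hρ : map (algebraMap ℝ ℂ) (normSq : MvPolynomial (Fin 3) ℝ) = normSq := map_normSq _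
    rw [hρ]
    ring

/-! ### Divisibility by `ρ` from the chart -/

/-- ★ **Complex**: a homogeneous polynomial of degree `k` with zero isotropic chart is `ρ` times a homogeneous polynomial of degree
`k − 2`. [folklore] -/
theorem exists_eq_normSq_mul_of_chartT_eq_zero' {F : MvPolynomial (Fin 3) ℂ} {k : ℕ} (hF : F.IsHomogeneous k)
    (hchart : chartT F = 0) : ∃ c : MvPolynomial (Fin 3) ℂ, c.IsHomogeneous (k - 2) ∧ F = normSq * c := by
  obtain ⟨h, c, hh, hΔ, hc, hF'⟩ := exists_harmonic_add_normSq_mul_complex hF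
  have hh0 : h = 0 := by
    refine eq_zero_of_chartT_eq_zero hh hΔ ?_
    have := hchart
    rw [hF', chartT_add, chartT_mul, chartT_normSq, zero_mul, add_zero] at this
    exact this
  exact ⟨c, hc, by rw [hF', hh0, zero_add]⟩

/-- ★ **Real**: a real homogeneous polynomial of degree `k` whose complexification has zero isotropic chart is `ρ` times a real
homogeneous polynomial of degree `k − 2`. [folklore] -/
theorem exists_eq_normSq_mul_of_chartT_map_eq_zero' {F : MvPolynomial (Fin 3) ℝ} {k : ℕ} (hF : F.IsHomogeneous k)
    (hchart : chartT (map (algebraMap ℝ ℂ) F) = 0) : ∃ c : MvPolynomial (Fin 3) ℝ, c.IsHomogeneous (k - 2) ∧ F = normSq * c := by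
  obtain ⟨h, c, hh, hΔ, hc, hF'⟩ := exists_harmonic_add_normSq_mul_real hF
  have hh0 : h = 0 := by
    refine eq_zero_of_chartT_map_eq_zero hh hΔ ?_
    have := hchart
    rw [hF', map_add, map_mul, map_normSq, chartT_add, chartT_mul, chartT_normSq, zero_mul, add_zero] at this
    exact this
  exact ⟨c, hc, by rw [hF', hh0, zero_add]⟩

end Summit.NavierStokesRegularity.NavierStokesRegularity.Theorems.PoloidalLiouville.HorizonTower.Zonal

end
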